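import Literature.MathematicalPhysics.QuantumFieldTheory.Balaban1983to89.B12PartitionUnity270
import Literature.MathematicalPhysics.QuantumFieldTheory.Balaban1983to89.B12ZetaWitness

/-!
# `Balaban1983to89.B12Profile270Witness` — [Balaban1987RG1] p. 270 «ζ has derivatives up to the second order bounded
by 5»: the EXISTENCE side — every first-order bound `> 3` (in particular the printed `5`) and every second-order bound
`> 36` is realised by a `C₀^∞` profile with all the other printed requirements; `36` itself is not

HONEST FRAMING (cell `lit-balaban`, verbatim): statement-level skeleton of published theorems with citation tags;
proofs where landed; nothing here is a claim about the Yang–Mills mass gap.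

CITATION HEADER.  T. Bałaban, *Renormalization group approach to lattice gauge field theories. I. Generation of
effective actions in a small field approximation and a coupling constant renormalization in four dimensions*,
Commun. Math. Phys. **109** (1987) 249–301, doi:10.1007/bf01215223 [Balaban1987RG1] (cell paper B12 = «[I]»;
held text `paper:balaban1987-cmp109-rg-i-small-field`, journal page = PDF page + 248).  Unit `lit-balaban-r09`
gen 20 (display owner of block B12), SKELETON row `B12.Def@270` (definition row; head unchanged), GAPS G-B12-01 /
pub-balaban G-adv9-1.

WHAT IS PRINTED (verbatim, p. 270 [PDF 22]).  *«… we take a partition of unity 1 = Σ_□ ζ_□ with smooth functions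
ζ_□. More exactly we assume that if y is a center of the cube □, then ζ_□(x) = Π_{μ=1}^d ζ(M⁻¹(x_μ − y_μ)), where
ζ ∈ C₀^∞(R¹), ζ(t) = 1 for |t| ≦ 1/3, ζ(t) = 0 for |t| ≧ 2/3, ζ has derivatives up to the second order bounded
by 5.»*  (The constant enters (3.11)–(3.16), (3.31) only as an `O(1)`.)

STATE OF THE TREE BEFORE THIS FILE.  `B12PartitionUnity270` (r09 gen 2, p242559) constructs the profile of record
`zeta` and proves `thirtySix_le_deriv2`: EVERY `C²` profile with the two plateaus has `sup|ζ″| ≥ 36`, so the printed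
`5` is impossible for the second derivative; pub-balaban's `B12ZetaWitness` (b2b-balaban-b12-g5) re-certifies this
(`thirtySix_le`, `not_exists_printed_zeta`) and records, UNCHECKED, that «36 is the infimum … and is not attained» and
that «the first-derivative bound 5 is consistent: only sup|ζ′| ≥ 3 is forced»; `B12Profile270Bounds` (r09 gen 16,
p323835) shows that the profile of record has `sup|ζ′| = 6` (so IT violates the printed first-order `5` too) and
`|ζ″| ≤ 144`, and that every `C¹` profile has `|ζ′| > 3` somewhere (`exists_three_lt_abs_deriv`).  What was missing
is the existence side: is the printed first-order `5` achieved by SOME admissible profile, and which second-order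
constants are?

WHAT THIS MODULE PROVES (0 sorry; no `Prop` fact; definitions with bodies; axioms standard).  KIND «(ours)» (G.5-54):
witness constructions delimiting the scope of a typed printed sentence — no print provenance is claimed for the
constructions, and nothing of the series is asserted.
§1  the smooth step of half-width `ε`: `stepE ε x = ST((x + ε)/(2ε))` (`ST` = Mathlib's `Real.smoothTransition`;
    `0` on `(−∞, −ε]`, `1` on `[ε, ∞)`, monotone, `C^∞`, `Φ_ε(x) + Φ_ε(−x) = 1` from `ST(1 − x) = 1 − ST(x)`);
§2  its primitive `rampE ε x = ∫₀ˣ Φ_ε` (`C^∞` by the fundamental theorem of calculus, constant on `(−∞, −ε]`,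
    slope `1` on `[ε, ∞)`, `Ψ_ε(x) − Ψ_ε(−x) = x`);
§3  THE FIRST-ORDER FAMILY `ζ_{A,ε} = F_ε − F_ε(· + 1)`, `F_ε(t) = 1 − (Ψ_ε(t − 1/3 − ε) − Ψ_ε(t − 2/3 + ε))/(1/3 − 2ε)`
    (`0 < ε < 1/6`): `C^∞`, `= 1` on `|t| ≤ 1/3`, `= 0` on `|t| ≥ 2/3`, `0 ≤ ζ ≤ 1`, even, `tsupport ⊆ [−2/3, 2/3]`,
    the partition of unity `Σ_{n=−N}^{N} ζ(t − n) = 1` (`|t| ≤ N`; telescoping, as for the profile of record), and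
    **`|ζ_{A,ε}′| ≤ 3/(1 − 6ε)`** (`abs_deriv_zetaA_le`: `F_ε′ = −(Φ_ε(·) − Φ_ε(·))/(1/3 − 2ε)` with the bracket in
    `[0, 1]`, and the two translates of `F_ε′` have disjoint supports);
§4  THE SECOND-ORDER FAMILY `ζ_{B,ε} = G_ε − G_ε(· + 1)`,
    `G_ε(t) = 1 − (4/(1/3 − 2ε)²)(Ω_ε(t − 1/3 − ε) − 2Ω_ε(t − 1/2) + Ω_ε(t − 2/3 + ε))`, `Ω_ε = ∫₀ˣ Ψ_ε` (a smoothing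
    of the extremal `C^{1,1}` spline whose second derivative is `∓36/(1 − 6ε)²` on the two halves of
    `[1/3 + ε, 2/3 − ε]`): the same list of properties and **`|ζ_{B,ε}″| ≤ 36/(1 − 6ε)²`** (`abs_deriv2_zetaB_le`); the
    plateau identities are the affine/quadratic behaviour of `Ω_ε` off `[−ε, ε]` (`ramp2E_sub_ramp2E_of_le/of_ge`),
    the symmetry `G_ε(t) + G_ε(1 − t) = 1` is `Ω_ε(x) + Ω_ε(−x) = x²/2`, and `0 ≤ ζ ≤ 1` is the monotonicity of the
    step (`rampE_bracket_nonneg`, comparing the two windows of equal length `1/6 − ε`);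
§5  **`36` IS NOT ATTAINED** (`exists_thirtySix_lt_abs_deriv2`): every `C²` function with the two plateaus has
    `|ζ″| > 36` somewhere — if `|ζ″| ≤ 36` the one-sided Taylor estimates of `B12ZetaWitness` (used BY NAME:
    `deriv_eq_zero_on_closure`, `abs_deriv_le_mul_abs_sub`, `monotoneOn_Ici_add_sq`, `monotoneOn_Iic_sub_sq`) pin
    `ζ` to the parabolas `1 − 18(t − 1/3)²` on `[1/3, 1/2]` and `18(t − 2/3)²` on `[1/2, 2/3]`, whence `ζ″ = −36` on
    `(1/3, 1/2)` and `ζ″ = 36` on `(1/2, 2/3)`, contradicting the continuity of `ζ″` at `1/2`;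
§6  THE EXISTENCE THEOREMS: **`exists_profile_abs_deriv_le`: every `D > 3` is a first-derivative bound of an admissible
    `C₀^∞` profile** (take `ε = (1 − 3/D)/6`), in particular **`exists_profile_abs_deriv_le_five`: the printed
    first-order constant `5` IS achieved**; **`exists_profile_abs_deriv2_le`: every `K > 36` is a second-derivative
    bound of an admissible profile** (`ε = (1 − 6/√K)/6`); `printed_derivative_bounds_p270` collects the verdict on the
    printed sentence.  With `exists_three_lt_abs_deriv` and `thirtySix_le_deriv2` the admissible constants are EXACTLY
    `(3, ∞)` for the first and `(36, ∞)` for the second derivative (neither infimum attained; no single profile is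
    claimed to realise both families of bounds simultaneously — not needed, and the printed `5` is unattainable for
    `ζ″` anyway).
READING NOTE (row B12.Def@270).  The PARTIAL qualifier of the row now reads: printed «≤ 5» — first-order half
REALISED (by `ζ_{A,1/15}`, not by the profile of record), second-order half REFUTED for every profile (`≥ 36`, and
`> 36` strictly), every constant `> 36` realised.  Imports `B12PartitionUnity270` (vocabulary of the row; nothing of
it is re-proved) and `B12ZetaWitness` (the four calculus lemmas named in §5); Mathlib otherwise
(`Real.smoothTransition`, `intervalIntegral`, `Continuous.integral_hasStrictDerivAt`, `contDiff_infty_iff_deriv`).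
The symmetry `ST(1 − x) = 1 − ST(x)` is re-proved here in three lines (a `private` twin exists in
`B4PartitionUnity22`); no other statement of the tree is duplicated.
-/

noncomputable section

namespace Literature.MathematicalPhysics.QuantumFieldTheory.Balaban1983to89.B12Profile270Witness

open Set Real MeasureTheory intervalIntegral
open scoped Topology ContDiff

/-! ## §1  The smooth step `Φ_ε` of half-width `ε` -/

/-- Symmetry of Mathlib's smooth transition: `ST(1 − x) = 1 − ST(x)` (private helper; a `private` twin lives in
`B4PartitionUnity22`). [folklore] -/
private theorem smoothTransition_one_sub (x : ℝ) :
    Real.smoothTransition (1 - x) = 1 - Real.smoothTransition x := by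
  unfold Real.smoothTransition
  rw [sub_sub_cancel]
  have h1 := Real.smoothTransition.pos_denom x
  have h2 : 0 < expNegInvGlue (1 - x) + expNegInvGlue x := by rwa [add_comm]
  field_simp
  ring

/-- The smooth step of half-width `ε`: `Φ_ε(x) = ST((x + ε)/(2ε))` (`0` for `x ≤ −ε`, `1` for `x ≥ ε`). (ours)
[cite: Balaban1987RG1, §3 p.270] -/
def stepE (ε x : ℝ) : ℝ := Real.smoothTransition ((x + ε) / (2 * ε))

variable {ε : ℝ}

/-- `Φ_ε = 0` on `(−∞, −ε]`. (ours) [cite: Balaban1987RG1, §3 p.270] -/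
theorem stepE_eq_zero (hε : 0 < ε) {x : ℝ} (hx : x ≤ -ε) : stepE ε x = 0 :=
  Real.smoothTransition.zero_of_nonpos (div_nonpos_of_nonpos_of_nonneg (by linarith) (by linarith))

/-- `Φ_ε = 1` on `[ε, ∞)`. (ours) [cite: Balaban1987RG1, §3 p.270] -/
theorem stepE_eq_one (hε : 0 < ε) {x : ℝ} (hx : ε ≤ x) : stepE ε x = 1 :=
  Real.smoothTransition.one_of_one_le (by rw [le_div_iff₀ (by linarith)]; linarith)

/-- `0 ≤ Φ_ε`. (ours) [cite: Balaban1987RG1, §3 p.270] -/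
theorem stepE_nonneg (ε x : ℝ) : 0 ≤ stepE ε x := Real.smoothTransition.nonneg _

/-- `Φ_ε ≤ 1`. (ours) [cite: Balaban1987RG1, §3 p.270] -/
theorem stepE_le_one (ε x : ℝ) : stepE ε x ≤ 1 := Real.smoothTransition.le_one _

/-- `Φ_ε` is monotone. (ours) [cite: Balaban1987RG1, §3 p.270] -/
theorem stepE_monotone (hε : 0 < ε) : Monotone (stepE ε) := fun a b hab =>
  Real.smoothTransition.monotone (div_le_div_of_nonneg_right (by linarith) (by linarith))

/-- `Φ_ε(x) + Φ_ε(−x) = 1` (`Φ_ε′` is an even bump). (ours) [cite: Balaban1987RG1, §3 p.270] -/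
theorem stepE_add_stepE_neg (hε : 0 < ε) (x : ℝ) : stepE ε x + stepE ε (-x) = 1 := by
  unfold stepE
  have h : (-x + ε) / (2 * ε) = 1 - (x + ε) / (2 * ε) := by
    field_simp
    ring
  rw [h, smoothTransition_one_sub]
  ring

/-- `Φ_ε ∈ C^∞`. (ours) [cite: Balaban1987RG1, §3 p.270] -/
theorem contDiff_stepE (ε : ℝ) : ContDiff ℝ ∞ (stepE ε) :=
  Real.smoothTransition.contDiff.comp ((contDiff_id.add contDiff_const).div_const _)

/-- `Φ_ε` is continuous. (ours) [cite: Balaban1987RG1, §3 p.270] -/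
theorem continuous_stepE (ε : ℝ) : Continuous (stepE ε) := (contDiff_stepE ε).continuous

/-! ## §2  The smooth ramp `Ψ_ε = ∫₀ˣ Φ_ε` -/

/-- `Ψ_ε(x) = ∫₀ˣ Φ_ε`: smooth, convex, constant on `(−∞, −ε]`, slope `1` on `[ε, ∞)`. (ours)
[cite: Balaban1987RG1, §3 p.270] -/
def rampE (ε x : ℝ) : ℝ := ∫ u in (0 : ℝ)..x, stepE ε u

/-- `Ψ_ε′ = Φ_ε` (fundamental theorem of calculus). (ours) [cite: Balaban1987RG1, §3 p.270] -/
theorem hasDerivAt_rampE (ε x : ℝ) : HasDerivAt (rampE ε) (stepE ε x) x :=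
  ((continuous_stepE ε).integral_hasStrictDerivAt 0 x).hasDerivAt

/-- `Ψ_ε′ = Φ_ε`. (ours) [cite: Balaban1987RG1, §3 p.270] -/
theorem deriv_rampE (ε : ℝ) : deriv (rampE ε) = stepE ε :=
  funext fun x => (hasDerivAt_rampE ε x).deriv

/-- `Ψ_ε` is differentiable. (ours) [cite: Balaban1987RG1, §3 p.270] -/
theorem differentiable_rampE (ε : ℝ) : Differentiable ℝ (rampE ε) := fun x =>
  (hasDerivAt_rampE ε x).differentiableAt

/-- `Ψ_ε ∈ C^∞` (its derivative is). (ours) [cite: Balaban1987RG1, §3 p.270] -/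
theorem contDiff_rampE (ε : ℝ) : ContDiff ℝ ∞ (rampE ε) := by
  rw [contDiff_infty_iff_deriv, deriv_rampE]
  exact ⟨differentiable_rampE ε, contDiff_stepE ε⟩

/-- `Ψ_ε` is continuous. (ours) [cite: Balaban1987RG1, §3 p.270] -/
theorem continuous_rampE (ε : ℝ) : Continuous (rampE ε) := (contDiff_rampE ε).continuous

/-- `Ψ_ε` is monotone (`Φ_ε ≥ 0`). (ours) [cite: Balaban1987RG1, §3 p.270] -/
theorem rampE_monotone (ε : ℝ) : Monotone (rampE ε) :=
  monotone_of_deriv_nonneg (differentiable_rampE ε) fun x => by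
    rw [deriv_rampE]; exact stepE_nonneg ε x

/-- `Ψ_ε(x) − Ψ_ε(y) = ∫_y^x Φ_ε`. (ours) [cite: Balaban1987RG1, §3 p.270] -/
theorem rampE_sub_rampE (ε x y : ℝ) : rampE ε x - rampE ε y = ∫ u in y..x, stepE ε u :=
  integral_interval_sub_left ((continuous_stepE ε).intervalIntegrable _ _)
    ((continuous_stepE ε).intervalIntegrable _ _)

/-- On `[ε, ∞)` the ramp has slope exactly `1`. (ours) [cite: Balaban1987RG1, §3 p.270] -/
theorem rampE_sub_rampE_of_le (hε : 0 < ε) {x y : ℝ} (hx : ε ≤ x) (hy : ε ≤ y) :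
    rampE ε x - rampE ε y = x - y := by
  rw [rampE_sub_rampE]
  have : ∫ u in y..x, stepE ε u = ∫ _ in y..x, (1 : ℝ) := by
    refine integral_congr fun t ht => ?_
    have hεt : ε ≤ t := by
      rcases le_total y x with h | h
      · rw [uIcc_of_le h] at ht; exact hy.trans ht.1
      · rw [uIcc_of_ge h] at ht; exact hx.trans ht.1
    simp [stepE_eq_one hε hεt]
  rw [this, intervalIntegral.integral_const, smul_eq_mul, mul_one]

/-- On `(−∞, −ε]` the ramp is constant. (ours) [cite: Balaban1987RG1, §3 p.270] -/
theorem rampE_eq_rampE_of_le (hε : 0 < ε) {x y : ℝ} (hx : x ≤ -ε) (hy : y ≤ -ε) :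
    rampE ε x = rampE ε y := by
  have h := rampE_sub_rampE ε x y
  have h0 : ∫ u in y..x, stepE ε u = 0 := by
    rw [show (0 : ℝ) = ∫ _ in y..x, (0 : ℝ) by simp]
    refine integral_congr fun t ht => ?_
    have hεt : t ≤ -ε := by
      rcases le_total y x with h | h
      · rw [uIcc_of_le h] at ht; exact ht.2.trans hx
      · rw [uIcc_of_ge h] at ht; exact ht.2.trans hy
    simp [stepE_eq_zero hε hεt]
  linarith

/-- The odd part of the ramp is `x/2`: `Ψ_ε(x) − Ψ_ε(−x) = x`. (ours) [cite: Balaban1987RG1, §3 p.270] -/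
theorem rampE_sub_rampE_neg (hε : 0 < ε) (x : ℝ) : rampE ε x - rampE ε (-x) = x := by
  have hd : ∀ t, HasDerivAt (fun t => rampE ε t - rampE ε (-t) - t) 0 t := by
    intro t
    have h1 := hasDerivAt_rampE ε t
    have h2 : HasDerivAt (fun t => rampE ε (-t)) ((-1 : ℝ) • stepE ε (-t)) t := by
      simpa [Function.comp_def] using (hasDerivAt_rampE ε (-t)).scomp t (hasDerivAt_neg t)
    refine ((h1.sub h2).sub (hasDerivAt_id t)).congr_deriv ?_
    have := stepE_add_stepE_neg hε t
    simp only [smul_eq_mul]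
    linarith
  have hc := is_const_of_deriv_eq_zero (fun t => (hd t).differentiableAt) (fun t => (hd t).deriv) x 0
  have h0 : rampE ε 0 - rampE ε (-0) - 0 = 0 := by simp [rampE]
  rw [h0] at hc
  linarith

/-- `0 ≤ Ψ_ε(x) − Ψ_ε(y) ≤ x − y` for `y ≤ x`. (ours) [cite: Balaban1987RG1, §3 p.270] -/
theorem rampE_sub_rampE_le (ε : ℝ) {x y : ℝ} (hxy : y ≤ x) : rampE ε x - rampE ε y ≤ x - y := by
  rw [rampE_sub_rampE]
  calc ∫ u in y..x, stepE ε u ≤ ∫ _ in y..x, (1 : ℝ) :=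
        intervalIntegral.integral_mono_on hxy ((continuous_stepE ε).intervalIntegrable _ _)
          (continuous_const.intervalIntegrable _ _) fun u _ => stepE_le_one ε u
    _ = x - y := by rw [intervalIntegral.integral_const, smul_eq_mul, mul_one]

/-! ## §3  The first-order family `ζ_{A,ε}` -/

/-- The decreasing half-profile `F_ε(t) = 1 − (Ψ_ε(t − 1/3 − ε) − Ψ_ε(t − 2/3 + ε))/(1/3 − 2ε)`:
`1` on `(−∞, 1/3]`, `0` on `[2/3, ∞)`, slope at most `3/(1 − 6ε)` in size. (ours) [cite: Balaban1987RG1, §3 p.270] -/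
def halfA (ε t : ℝ) : ℝ :=
  1 - (rampE ε (t - (1 / 3 + ε)) - rampE ε (t - (2 / 3 - ε))) / (1 / 3 - 2 * ε)

/-- The first-order profile `ζ_{A,ε}(t) = F_ε(t) − F_ε(t + 1)`. (ours) [cite: Balaban1987RG1, §3 p.270] -/
def zetaA (ε t : ℝ) : ℝ := halfA ε t - halfA ε (t + 1)

/-- `F_ε = 1` on `(−∞, 1/3]` (both ramps are in their constant region). (ours) [cite: Balaban1987RG1, §3 p.270] -/
theorem halfA_eq_one (hε : 0 < ε) (hε' : ε < 1 / 6) {t : ℝ} (ht : t ≤ 1 / 3) : halfA ε t = 1 := by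
  unfold halfA
  rw [rampE_eq_rampE_of_le hε (show t - (1 / 3 + ε) ≤ -ε by linarith) (show t - (2 / 3 - ε) ≤ -ε by linarith)]
  simp

/-- `F_ε = 0` on `[2/3, ∞)` (both ramps have slope `1`, the bracket equals the window `1/3 − 2ε`).
(ours) [cite: Balaban1987RG1, §3 p.270] -/
theorem halfA_eq_zero (hε : 0 < ε) (hε' : ε < 1 / 6) {t : ℝ} (ht : 2 / 3 ≤ t) : halfA ε t = 0 := by
  unfold halfA
  rw [rampE_sub_rampE_of_le hε (show ε ≤ t - (1 / 3 + ε) by linarith) (show ε ≤ t - (2 / 3 - ε) by linarith)]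
  have hw : (1 / 3 - 2 * ε) ≠ 0 := by linarith
  rw [show t - (1 / 3 + ε) - (t - (2 / 3 - ε)) = 1 / 3 - 2 * ε by ring, div_self hw, sub_self]

/-- `F_ε′(t) = −(Φ_ε(t − 1/3 − ε) − Φ_ε(t − 2/3 + ε))/(1/3 − 2ε)`. (ours) [cite: Balaban1987RG1, §3 p.270] -/
theorem hasDerivAt_halfA (ε t : ℝ) :
    HasDerivAt (halfA ε) (-((stepE ε (t - (1 / 3 + ε)) - stepE ε (t - (2 / 3 - ε))) / (1 / 3 - 2 * ε))) t := by
  unfold halfA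
  have h1 : HasDerivAt (fun t => rampE ε (t - (1 / 3 + ε))) (stepE ε (t - (1 / 3 + ε))) t :=
    (hasDerivAt_rampE ε (t - (1 / 3 + ε))).comp_sub_const t (1 / 3 + ε)
  have h2 : HasDerivAt (fun t => rampE ε (t - (2 / 3 - ε))) (stepE ε (t - (2 / 3 - ε))) t :=
    (hasDerivAt_rampE ε (t - (2 / 3 - ε))).comp_sub_const t (2 / 3 - ε)
  have h3 := ((h1.sub h2).div_const (1 / 3 - 2 * ε)).const_sub 1
  simpa using h3

/-- `F_ε′` in closed form. (ours) [cite: Balaban1987RG1, §3 p.270] -/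
theorem deriv_halfA (ε t : ℝ) :
    deriv (halfA ε) t = -((stepE ε (t - (1 / 3 + ε)) - stepE ε (t - (2 / 3 - ε))) / (1 / 3 - 2 * ε)) :=
  (hasDerivAt_halfA ε t).deriv

/-- `F_ε` is differentiable. (ours) [cite: Balaban1987RG1, §3 p.270] -/
theorem differentiable_halfA (ε : ℝ) : Differentiable ℝ (halfA ε) := fun t =>
  (hasDerivAt_halfA ε t).differentiableAt

/-- `F_ε ∈ C^∞`. (ours) [cite: Balaban1987RG1, §3 p.270] -/
theorem contDiff_halfA (ε : ℝ) : ContDiff ℝ ∞ (halfA ε) := by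
  unfold halfA
  exact contDiff_const.sub ((((contDiff_rampE ε).comp (contDiff_id.sub contDiff_const)).sub
    ((contDiff_rampE ε).comp (contDiff_id.sub contDiff_const))).div_const _)

/-- The bracket `Φ_ε(t − 1/3 − ε) − Φ_ε(t − 2/3 + ε)` lies in `[0, 1]`. (ours) [cite: Balaban1987RG1, §3 p.270] -/
theorem stepE_sub_stepE_mem (hε : 0 < ε) (hε' : ε < 1 / 6) (t : ℝ) :
    stepE ε (t - (1 / 3 + ε)) - stepE ε (t - (2 / 3 - ε)) ∈ Icc (0 : ℝ) 1 := by
  constructor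
  · have := stepE_monotone hε (show t - (2 / 3 - ε) ≤ t - (1 / 3 + ε) by linarith)
    linarith
  · linarith [stepE_le_one ε (t - (1 / 3 + ε)), stepE_nonneg ε (t - (2 / 3 - ε))]

/-- **`|F_ε′| ≤ 3/(1 − 6ε)`**. (ours) [cite: Balaban1987RG1, §3 p.270] -/
theorem abs_deriv_halfA_le (hε : 0 < ε) (hε' : ε < 1 / 6) (t : ℝ) :
    |deriv (halfA ε) t| ≤ 3 / (1 - 6 * ε) := by
  rw [deriv_halfA, abs_neg, abs_div, abs_of_pos (show (0:ℝ) < 1 / 3 - 2 * ε by linarith)]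
  obtain ⟨h0, h1⟩ := stepE_sub_stepE_mem hε hε' t
  rw [abs_of_nonneg h0, div_le_div_iff₀ (by linarith) (by linarith)]
  nlinarith

/-- `F_ε′ = 0` on `(−∞, 1/3]`. (ours) [cite: Balaban1987RG1, §3 p.270] -/
theorem deriv_halfA_eq_zero_of_le (hε : 0 < ε) (hε' : ε < 1 / 6) {t : ℝ} (ht : t ≤ 1 / 3) :
    deriv (halfA ε) t = 0 := by
  rw [deriv_halfA, stepE_eq_zero hε (show t - (1 / 3 + ε) ≤ -ε by linarith),
    stepE_eq_zero hε (show t - (2 / 3 - ε) ≤ -ε by linarith)]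
  simp

/-- `F_ε′ = 0` on `[2/3, ∞)`. (ours) [cite: Balaban1987RG1, §3 p.270] -/
theorem deriv_halfA_eq_zero_of_ge (hε : 0 < ε) (hε' : ε < 1 / 6) {t : ℝ} (ht : 2 / 3 ≤ t) :
    deriv (halfA ε) t = 0 := by
  rw [deriv_halfA, stepE_eq_one hε (show ε ≤ t - (1 / 3 + ε) by linarith),
    stepE_eq_one hε (show ε ≤ t - (2 / 3 - ε) by linarith)]
  simp

/-- `F_ε` is antitone. (ours) [cite: Balaban1987RG1, §3 p.270] -/
theorem halfA_antitone (hε : 0 < ε) (hε' : ε < 1 / 6) : Antitone (halfA ε) :=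
  antitone_of_deriv_nonpos (differentiable_halfA ε) fun t => by
    rw [deriv_halfA, neg_nonpos]
    exact div_nonneg (stepE_sub_stepE_mem hε hε' t).1 (by linarith)

/-- `0 ≤ F_ε ≤ 1`. (ours) [cite: Balaban1987RG1, §3 p.270] -/
theorem halfA_mem_Icc (hε : 0 < ε) (hε' : ε < 1 / 6) (t : ℝ) : halfA ε t ∈ Icc (0 : ℝ) 1 := by
  rcases le_total t (1 / 3) with h | h
  · rw [halfA_eq_one hε hε' h]; exact ⟨zero_le_one, le_rfl⟩
  rcases le_total (2 / 3) t with h' | h'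
  · rw [halfA_eq_zero hε hε' h']; exact ⟨le_rfl, zero_le_one⟩
  exact ⟨(halfA_eq_zero hε hε' (le_refl _)).symm.le.trans (halfA_antitone hε hε' h'),
    (halfA_antitone hε hε' h).trans (halfA_eq_one hε hε' (le_refl _)).le⟩

/-- **Point symmetry about `(1/2, 1/2)`**: `F_ε(t) + F_ε(1 − t) = 1`. (ours) [cite: Balaban1987RG1, §3 p.270] -/
theorem halfA_add_halfA_one_sub (hε : 0 < ε) (hε' : ε < 1 / 6) (t : ℝ) :
    halfA ε t + halfA ε (1 - t) = 1 := by
  unfold halfA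
  have h1 := rampE_sub_rampE_neg hε (t - (1 / 3 + ε))
  have h2 := rampE_sub_rampE_neg hε (t - (2 / 3 - ε))
  rw [show 1 - t - (1 / 3 + ε) = -(t - (2 / 3 - ε)) by ring, show 1 - t - (2 / 3 - ε) = -(t - (1 / 3 + ε)) by ring]
  have hw : (1 / 3 - 2 * ε) ≠ 0 := by linarith
  have key : rampE ε (t - (1 / 3 + ε)) - rampE ε (t - (2 / 3 - ε))
      + (rampE ε (-(t - (2 / 3 - ε))) - rampE ε (-(t - (1 / 3 + ε)))) = 1 / 3 - 2 * ε := by linarith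
  calc 1 - (rampE ε (t - (1 / 3 + ε)) - rampE ε (t - (2 / 3 - ε))) / (1 / 3 - 2 * ε)
        + (1 - (rampE ε (-(t - (2 / 3 - ε))) - rampE ε (-(t - (1 / 3 + ε)))) / (1 / 3 - 2 * ε))
      = 2 - (rampE ε (t - (1 / 3 + ε)) - rampE ε (t - (2 / 3 - ε))
        + (rampE ε (-(t - (2 / 3 - ε))) - rampE ε (-(t - (1 / 3 + ε))))) / (1 / 3 - 2 * ε) := by ring
    _ = 1 := by rw [key, div_self hw]; ring


/-! ### The profile `ζ_{A,ε} = F_ε − F_ε(· + 1)` -/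

/-- **«ζ(t) = 1 for |t| ≦ 1/3»** for `ζ_{A,ε}`. (ours) [cite: Balaban1987RG1, §3 p.270] -/
theorem zetaA_eq_one (hε : 0 < ε) (hε' : ε < 1 / 6) {t : ℝ} (ht : |t| ≤ 1 / 3) : zetaA ε t = 1 := by
  obtain ⟨h1, h2⟩ := abs_le.mp ht
  unfold zetaA
  rw [halfA_eq_one hε hε' h2, halfA_eq_zero hε hε' (by linarith)]
  norm_num

/-- **«ζ(t) = 0 for |t| ≧ 2/3»** for `ζ_{A,ε}`. (ours) [cite: Balaban1987RG1, §3 p.270] -/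
theorem zetaA_eq_zero (hε : 0 < ε) (hε' : ε < 1 / 6) {t : ℝ} (ht : 2 / 3 ≤ |t|) : zetaA ε t = 0 := by
  unfold zetaA
  rcases le_abs'.mp ht with h | h
  · rw [halfA_eq_one hε hε' (by linarith), halfA_eq_one hε hε' (by linarith)]; norm_num
  · rw [halfA_eq_zero hε hε' h, halfA_eq_zero hε hε' (by linarith)]; norm_num

/-- `0 ≤ ζ_{A,ε}`. (ours) [cite: Balaban1987RG1, §3 p.270] -/
theorem zetaA_nonneg (hε : 0 < ε) (hε' : ε < 1 / 6) (t : ℝ) : 0 ≤ zetaA ε t := by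
  unfold zetaA
  have := halfA_antitone hε hε' (show t ≤ t + 1 by linarith)
  linarith

/-- `ζ_{A,ε} ≤ 1`. (ours) [cite: Balaban1987RG1, §3 p.270] -/
theorem zetaA_le_one (hε : 0 < ε) (hε' : ε < 1 / 6) (t : ℝ) : zetaA ε t ≤ 1 := by
  unfold zetaA
  linarith [(halfA_mem_Icc hε hε' t).2, (halfA_mem_Icc hε hε' (t + 1)).1]

/-- `ζ_{A,ε}` is even (from the point symmetry of `F_ε`). (ours) [cite: Balaban1987RG1, §3 p.270] -/
theorem zetaA_neg (hε : 0 < ε) (hε' : ε < 1 / 6) (t : ℝ) : zetaA ε (-t) = zetaA ε t := by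
  unfold zetaA
  have h1 := halfA_add_halfA_one_sub hε hε' (-t)
  have h2 := halfA_add_halfA_one_sub hε hε' (t + 1)
  rw [show 1 - -t = t + 1 by ring] at h1
  rw [show 1 - (t + 1) = -t by ring] at h2
  have h3 := halfA_add_halfA_one_sub hε hε' t
  rw [show (1 : ℝ) - t = -t + 1 by ring] at h3
  linarith

/-- **«ζ ∈ C₀^∞(R¹)»**, smoothness of `ζ_{A,ε}`. (ours) [cite: Balaban1987RG1, §3 p.270] -/
theorem contDiff_zetaA (ε : ℝ) : ContDiff ℝ ∞ (zetaA ε) :=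
  (contDiff_halfA ε).sub ((contDiff_halfA ε).comp (contDiff_id.add contDiff_const))

/-- `ζ_{A,ε}′(t) = F_ε′(t) − F_ε′(t + 1)`. (ours) [cite: Balaban1987RG1, §3 p.270] -/
theorem hasDerivAt_zetaA (ε t : ℝ) :
    HasDerivAt (zetaA ε) (deriv (halfA ε) t - deriv (halfA ε) (t + 1)) t :=
  ((differentiable_halfA ε t).hasDerivAt).sub
    (((differentiable_halfA ε (t + 1)).hasDerivAt).comp_add_const t 1)

/-- `ζ_{A,ε}′` in terms of `F_ε′`. (ours) [cite: Balaban1987RG1, §3 p.270] -/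
theorem deriv_zetaA (ε t : ℝ) : deriv (zetaA ε) t = deriv (halfA ε) t - deriv (halfA ε) (t + 1) :=
  (hasDerivAt_zetaA ε t).deriv

/-- **`|ζ_{A,ε}′| ≤ 3/(1 − 6ε)`** — at most one of the two translates of `F_ε′` is nonzero at any point.
(ours) [cite: Balaban1987RG1, §3 p.270] -/
theorem abs_deriv_zetaA_le (hε : 0 < ε) (hε' : ε < 1 / 6) (t : ℝ) :
    |deriv (zetaA ε) t| ≤ 3 / (1 - 6 * ε) := by
  rw [deriv_zetaA]
  rcases le_or_gt t (1 / 3) with h | h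
  · rw [deriv_halfA_eq_zero_of_le hε hε' h, zero_sub, abs_neg]
    exact abs_deriv_halfA_le hε hε' _
  · rw [deriv_halfA_eq_zero_of_ge hε hε' (show 2 / 3 ≤ t + 1 by linarith), sub_zero]
    exact abs_deriv_halfA_le hε hε' _

/-- **«ζ ∈ C₀^∞(R¹)»**, support: `tsupport ζ_{A,ε} ⊆ [−2/3, 2/3] ⊂ ]−1, 1[`. (ours) [cite: Balaban1987RG1, §3 p.270] -/
theorem tsupport_zetaA_subset (hε : 0 < ε) (hε' : ε < 1 / 6) :
    tsupport (zetaA ε) ⊆ Icc (-(2 / 3)) (2 / 3) := by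
  apply closure_minimal _ isClosed_Icc
  intro t ht
  rw [Function.mem_support] at ht
  by_contra h
  apply ht
  apply zetaA_eq_zero hε hε'
  rw [mem_Icc, not_and_or, not_le, not_le] at h
  rcases h with h | h
  · rw [abs_of_neg (by linarith)]; linarith
  · rw [abs_of_pos (by linarith)]; linarith

/-- `ζ_{A,ε}` has compact support. (ours) [cite: Balaban1987RG1, §3 p.270] -/
theorem hasCompactSupport_zetaA (hε : 0 < ε) (hε' : ε < 1 / 6) : HasCompactSupport (zetaA ε) :=
  HasCompactSupport.of_support_subset_isCompact isCompact_Icc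
    (subset_tsupport (zetaA ε) |>.trans (tsupport_zetaA_subset hε hε'))

/-- Telescoping of the integer translates: `Σ_{k<m} ζ_{A,ε}(u − k) = F_ε(u + 1 − m) − F_ε(u + 1)`.
(ours) [cite: Balaban1987RG1, §3 p.270] -/
theorem sum_zetaA_range (ε u : ℝ) (m : ℕ) :
    ∑ k ∈ Finset.range m, zetaA ε (u - k) = halfA ε (u + 1 - m) - halfA ε (u + 1) := by
  induction m with
  | zero => simp
  | succ m ih =>
    rw [Finset.sum_range_succ, ih]
    unfold zetaA
    push_cast
    ring_nf

/-- **The partition of unity** `Σ_{n=−N}^{N} ζ_{A,ε}(t − n) = 1` for `|t| ≤ N`.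
(ours) [cite: Balaban1987RG1, §3 p.270] -/
theorem sum_zetaA_sub_int (hε : 0 < ε) (hε' : ε < 1 / 6) (N : ℕ) {t : ℝ} (ht : |t| ≤ N) :
    ∑ n ∈ Finset.Icc (-(N : ℤ)) N, zetaA ε (t - n) = 1 := by
  obtain ⟨h1, h2⟩ := abs_le.mp ht
  have himg : Finset.Icc (-(N : ℤ)) N = (Finset.range (2 * N + 1)).image (fun k : ℕ => (k : ℤ) - N) := by
    ext n
    simp only [Finset.mem_Icc, Finset.mem_image, Finset.mem_range]
    constructor
    · rintro ⟨hn1, hn2⟩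
      exact ⟨(n + N).toNat, by omega, by omega⟩
    · rintro ⟨k, hk, rfl⟩
      omega
  rw [himg, Finset.sum_image (by intro a _ b _ hab; simpa using hab)]
  have hsum : ∑ k ∈ Finset.range (2 * N + 1), zetaA ε (t - (((k : ℤ) - N : ℤ) : ℝ))
      = ∑ k ∈ Finset.range (2 * N + 1), zetaA ε (t + N - k) := by
    refine Finset.sum_congr rfl fun k _ => ?_
    push_cast
    ring_nf
  rw [hsum, sum_zetaA_range ε (t + N) (2 * N + 1), halfA_eq_one hε hε' (by push_cast; linarith),
    halfA_eq_zero hε hε' (by linarith)]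
  norm_num


/-! ## §4  The second-order family `ζ_{B,ε}` -/

/-- `Ω_ε(x) = ∫₀ˣ Ψ_ε` (second primitive of the smooth step). (ours) [cite: Balaban1987RG1, §3 p.270] -/
def ramp2E (ε x : ℝ) : ℝ := ∫ u in (0 : ℝ)..x, rampE ε u

/-- `Ω_ε′ = Ψ_ε` (fundamental theorem of calculus). (ours) [cite: Balaban1987RG1, §3 p.270] -/
theorem hasDerivAt_ramp2E (ε x : ℝ) : HasDerivAt (ramp2E ε) (rampE ε x) x :=
  ((continuous_rampE ε).integral_hasStrictDerivAt 0 x).hasDerivAt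

/-- `Ω_ε′ = Ψ_ε`. (ours) [cite: Balaban1987RG1, §3 p.270] -/
theorem deriv_ramp2E (ε : ℝ) : deriv (ramp2E ε) = rampE ε :=
  funext fun x => (hasDerivAt_ramp2E ε x).deriv

/-- `Ω_ε` is differentiable. (ours) [cite: Balaban1987RG1, §3 p.270] -/
theorem differentiable_ramp2E (ε : ℝ) : Differentiable ℝ (ramp2E ε) := fun x =>
  (hasDerivAt_ramp2E ε x).differentiableAt

/-- `Ω_ε ∈ C^∞`. (ours) [cite: Balaban1987RG1, §3 p.270] -/
theorem contDiff_ramp2E (ε : ℝ) : ContDiff ℝ ∞ (ramp2E ε) := by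
  rw [contDiff_infty_iff_deriv, deriv_ramp2E]
  exact ⟨differentiable_ramp2E ε, contDiff_rampE ε⟩

/-- `Ω_ε(x) − Ω_ε(y) = ∫_y^x Ψ_ε`. (ours) [cite: Balaban1987RG1, §3 p.270] -/
theorem ramp2E_sub_ramp2E (ε x y : ℝ) : ramp2E ε x - ramp2E ε y = ∫ u in y..x, rampE ε u :=
  integral_interval_sub_left ((continuous_rampE ε).intervalIntegrable _ _)
    ((continuous_rampE ε).intervalIntegrable _ _)

/-- On `(−∞, −ε]`, where `Ψ_ε` is constant, `Ω_ε` is affine. (ours) [cite: Balaban1987RG1, §3 p.270] -/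
theorem ramp2E_sub_ramp2E_of_le (hε : 0 < ε) {x y : ℝ} (hx : x ≤ -ε) (hy : y ≤ -ε) :
    ramp2E ε x - ramp2E ε y = rampE ε (-ε) * (x - y) := by
  rw [ramp2E_sub_ramp2E]
  have : ∫ u in y..x, rampE ε u = ∫ _ in y..x, rampE ε (-ε) := by
    refine integral_congr fun t ht => ?_
    have hεt : t ≤ -ε := by
      rcases le_total y x with h | h
      · rw [uIcc_of_le h] at ht; exact ht.2.trans hx
      · rw [uIcc_of_ge h] at ht; exact ht.2.trans hy
    exact rampE_eq_rampE_of_le hε hεt le_rfl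
  rw [this, intervalIntegral.integral_const, smul_eq_mul, mul_comm]

/-- On `[ε, ∞)`, where `Ψ_ε` has slope `1`, `Ω_ε` is quadratic. (ours) [cite: Balaban1987RG1, §3 p.270] -/
theorem ramp2E_sub_ramp2E_of_ge (hε : 0 < ε) {x y : ℝ} (hx : ε ≤ x) (hy : ε ≤ y) :
    ramp2E ε x - ramp2E ε y = rampE ε ε * (x - y) + ((x - ε) ^ 2 - (y - ε) ^ 2) / 2 := by
  rw [ramp2E_sub_ramp2E]
  have heq : ∫ u in y..x, rampE ε u = ∫ u in y..x, (rampE ε ε + (u - ε)) := by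
    refine integral_congr fun t ht => ?_
    have hεt : ε ≤ t := by
      rcases le_total y x with h | h
      · rw [uIcc_of_le h] at ht; exact hy.trans ht.1
      · rw [uIcc_of_ge h] at ht; exact hx.trans ht.1
    have := rampE_sub_rampE_of_le hε hεt le_rfl
    linarith
  have hderiv : ∀ u ∈ uIcc y x,
      HasDerivAt (fun u => rampE ε ε * u + (u - ε) ^ 2 / 2) (rampE ε ε + (u - ε)) u := by
    intro u _
    have h1 : HasDerivAt (fun u => rampE ε ε * u) (rampE ε ε * 1) u := (hasDerivAt_id u).const_mul _
    have h2 : HasDerivAt (fun u => (u - ε) ^ 2 / 2) (((2 : ℕ) : ℝ) * (u - ε) ^ (2 - 1) * 1 / 2) u :=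
      (((hasDerivAt_id u).sub_const ε).pow 2).div_const 2
    refine (h1.add h2).congr_deriv ?_
    push_cast
    ring
  rw [heq, integral_eq_sub_of_hasDerivAt hderiv ((continuous_const.add (continuous_id.sub
    continuous_const)).intervalIntegrable _ _)]
  ring

/-- The even part of `Ω_ε` is `x²/4`: `Ω_ε(x) + Ω_ε(−x) = x²/2`. (ours) [cite: Balaban1987RG1, §3 p.270] -/
theorem ramp2E_add_ramp2E_neg (hε : 0 < ε) (x : ℝ) : ramp2E ε x + ramp2E ε (-x) = x ^ 2 / 2 := by
  have hd : ∀ t, HasDerivAt (fun t => ramp2E ε t + ramp2E ε (-t) - t ^ 2 / 2) 0 t := by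
    intro t
    have h1 := hasDerivAt_ramp2E ε t
    have h2 : HasDerivAt (fun t => ramp2E ε (-t)) ((-1 : ℝ) • rampE ε (-t)) t := by
      simpa [Function.comp_def] using (hasDerivAt_ramp2E ε (-t)).scomp t (hasDerivAt_neg t)
    have h3 : HasDerivAt (fun t : ℝ => t ^ 2 / 2) (((2 : ℕ) : ℝ) * t ^ (2 - 1) * 1 / 2) t :=
      ((hasDerivAt_id t).pow 2).div_const 2
    refine ((h1.add h2).sub h3).congr_deriv ?_
    have := rampE_sub_rampE_neg hε t
    simp only [smul_eq_mul]
    push_cast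
    linarith
  have hc := is_const_of_deriv_eq_zero (fun t => (hd t).differentiableAt) (fun t => (hd t).deriv) x 0
  have h0 : ramp2E ε 0 + ramp2E ε (-0) - (0 : ℝ) ^ 2 / 2 = 0 := by simp [ramp2E]
  rw [h0] at hc
  linarith

/-- The decreasing half-profile of the second-order family,
`G_ε(t) = 1 − (4/(1/3 − 2ε)²)·(Ω_ε(t − 1/3 − ε) − 2Ω_ε(t − 1/2) + Ω_ε(t − 2/3 + ε))`. (ours)
[cite: Balaban1987RG1, §3 p.270] -/
def halfB (ε t : ℝ) : ℝ :=
  1 - 4 / (1 / 3 - 2 * ε) ^ 2 *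
    (ramp2E ε (t - (1 / 3 + ε)) - 2 * ramp2E ε (t - 1 / 2) + ramp2E ε (t - (2 / 3 - ε)))

/-- The second-order profile `ζ_{B,ε}(t) = G_ε(t) − G_ε(t + 1)`. (ours) [cite: Balaban1987RG1, §3 p.270] -/
def zetaB (ε t : ℝ) : ℝ := halfB ε t - halfB ε (t + 1)

/-- `G_ε = 1` on `(−∞, 1/3]` (all three `Ω_ε`-arguments lie in the affine region `(−∞, −ε]`;
the coefficients `1 − 2 + 1` and the two equal windows cancel).
(ours) [cite: Balaban1987RG1, §3 p.270] -/
theorem halfB_eq_one (hε : 0 < ε) (hε' : ε < 1 / 6) {t : ℝ} (ht : t ≤ 1 / 3) : halfB ε t = 1 := by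
  unfold halfB
  have h1 := ramp2E_sub_ramp2E_of_le hε (show t - (1 / 3 + ε) ≤ -ε by linarith) (show t - 1 / 2 ≤ -ε by linarith)
  have h2 := ramp2E_sub_ramp2E_of_le hε (show t - 1 / 2 ≤ -ε by linarith) (show t - (2 / 3 - ε) ≤ -ε by linarith)
  have key : ramp2E ε (t - (1 / 3 + ε)) - 2 * ramp2E ε (t - 1 / 2) + ramp2E ε (t - (2 / 3 - ε)) = 0 := by
    have : ramp2E ε (t - (1 / 3 + ε)) - 2 * ramp2E ε (t - 1 / 2) + ramp2E ε (t - (2 / 3 - ε))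
        = (ramp2E ε (t - (1 / 3 + ε)) - ramp2E ε (t - 1 / 2))
          - (ramp2E ε (t - 1 / 2) - ramp2E ε (t - (2 / 3 - ε))) := by ring
    rw [this, h1, h2]
    ring
  rw [key, mul_zero, sub_zero]

/-- `G_ε = 0` on `[2/3, ∞)` (all three arguments lie in the quadratic region `[ε, ∞)`;
the second difference of `x²/2` over the two windows of length `1/6 − ε` is `(1/6 − ε)²`, and `4/(1/3 − 2ε)² · (1/6 − ε)² = 1`).
(ours) [cite: Balaban1987RG1, §3 p.270] -/
theorem halfB_eq_zero (hε : 0 < ε) (hε' : ε < 1 / 6) {t : ℝ} (ht : 2 / 3 ≤ t) : halfB ε t = 0 := by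
  unfold halfB
  have h1 := ramp2E_sub_ramp2E_of_ge hε (show ε ≤ t - (1 / 3 + ε) by linarith) (show ε ≤ t - 1 / 2 by linarith)
  have h2 := ramp2E_sub_ramp2E_of_ge hε (show ε ≤ t - 1 / 2 by linarith) (show ε ≤ t - (2 / 3 - ε) by linarith)
  have key : ramp2E ε (t - (1 / 3 + ε)) - 2 * ramp2E ε (t - 1 / 2) + ramp2E ε (t - (2 / 3 - ε))
      = (1 / 6 - ε) ^ 2 := by
    have : ramp2E ε (t - (1 / 3 + ε)) - 2 * ramp2E ε (t - 1 / 2) + ramp2E ε (t - (2 / 3 - ε))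
        = (ramp2E ε (t - (1 / 3 + ε)) - ramp2E ε (t - 1 / 2))
          - (ramp2E ε (t - 1 / 2) - ramp2E ε (t - (2 / 3 - ε))) := by ring
    rw [this, h1, h2]
    ring
  rw [key]
  have hw' : (1 / 6 - ε) ≠ 0 := by linarith
  have h4 : 4 / (1 / 3 - 2 * ε) ^ 2 * (1 / 6 - ε) ^ 2 = 1 := by
    rw [show (1 / 3 - 2 * ε) = 2 * (1 / 6 - ε) by ring, div_mul_eq_mul_div,
      div_eq_one_iff_eq (pow_ne_zero 2 (mul_ne_zero two_ne_zero hw'))]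
    ring
  rw [h4, sub_self]

/-- `G_ε′(t) = −(4/(1/3 − 2ε)²)(Ψ_ε(t − 1/3 − ε) − 2Ψ_ε(t − 1/2) + Ψ_ε(t − 2/3 + ε))`.
(ours) [cite: Balaban1987RG1, §3 p.270] -/
theorem hasDerivAt_halfB (ε t : ℝ) :
    HasDerivAt (halfB ε) (-(4 / (1 / 3 - 2 * ε) ^ 2 *
      (rampE ε (t - (1 / 3 + ε)) - 2 * rampE ε (t - 1 / 2) + rampE ε (t - (2 / 3 - ε))))) t := by
  unfold halfB
  have h1 : HasDerivAt (fun t => ramp2E ε (t - (1 / 3 + ε))) (rampE ε (t - (1 / 3 + ε))) t :=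
    (hasDerivAt_ramp2E ε (t - (1 / 3 + ε))).comp_sub_const t (1 / 3 + ε)
  have h2 : HasDerivAt (fun t => 2 * ramp2E ε (t - 1 / 2)) (2 * rampE ε (t - 1 / 2)) t :=
    ((hasDerivAt_ramp2E ε (t - 1 / 2)).comp_sub_const t (1 / 2)).const_mul 2
  have h3 : HasDerivAt (fun t => ramp2E ε (t - (2 / 3 - ε))) (rampE ε (t - (2 / 3 - ε))) t :=
    (hasDerivAt_ramp2E ε (t - (2 / 3 - ε))).comp_sub_const t (2 / 3 - ε)
  have h4 := (((h1.sub h2).add h3).const_mul (4 / (1 / 3 - 2 * ε) ^ 2)).const_sub 1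
  simpa using h4

/-- `G_ε′` in closed form. (ours) [cite: Balaban1987RG1, §3 p.270] -/
theorem deriv_halfB (ε : ℝ) :
    deriv (halfB ε) = fun t => -(4 / (1 / 3 - 2 * ε) ^ 2 *
      (rampE ε (t - (1 / 3 + ε)) - 2 * rampE ε (t - 1 / 2) + rampE ε (t - (2 / 3 - ε)))) :=
  funext fun t => (hasDerivAt_halfB ε t).deriv

/-- `G_ε` is differentiable. (ours) [cite: Balaban1987RG1, §3 p.270] -/
theorem differentiable_halfB (ε : ℝ) : Differentiable ℝ (halfB ε) := fun t =>
  (hasDerivAt_halfB ε t).differentiableAt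

/-- `G_ε ∈ C^∞`. (ours) [cite: Balaban1987RG1, §3 p.270] -/
theorem contDiff_halfB (ε : ℝ) : ContDiff ℝ ∞ (halfB ε) := by
  unfold halfB
  exact contDiff_const.sub (contDiff_const.mul ((((contDiff_ramp2E ε).comp (contDiff_id.sub
    contDiff_const)).sub (contDiff_const.mul ((contDiff_ramp2E ε).comp (contDiff_id.sub
    contDiff_const)))).add ((contDiff_ramp2E ε).comp (contDiff_id.sub contDiff_const))))

/-- The second derivative of the half-profile:
`G_ε″(t) = −(4/(1/3 − 2ε)²)(Φ_ε(t − 1/3 − ε) − 2Φ_ε(t − 1/2) + Φ_ε(t − 2/3 + ε))`.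
(ours) [cite: Balaban1987RG1, §3 p.270] -/
theorem hasDerivAt_deriv_halfB (ε t : ℝ) :
    HasDerivAt (deriv (halfB ε)) (-(4 / (1 / 3 - 2 * ε) ^ 2 *
      (stepE ε (t - (1 / 3 + ε)) - 2 * stepE ε (t - 1 / 2) + stepE ε (t - (2 / 3 - ε))))) t := by
  rw [deriv_halfB]
  have h1 : HasDerivAt (fun t => rampE ε (t - (1 / 3 + ε))) (stepE ε (t - (1 / 3 + ε))) t :=
    (hasDerivAt_rampE ε (t - (1 / 3 + ε))).comp_sub_const t (1 / 3 + ε)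
  have h2 : HasDerivAt (fun t => 2 * rampE ε (t - 1 / 2)) (2 * stepE ε (t - 1 / 2)) t :=
    ((hasDerivAt_rampE ε (t - 1 / 2)).comp_sub_const t (1 / 2)).const_mul 2
  have h3 : HasDerivAt (fun t => rampE ε (t - (2 / 3 - ε))) (stepE ε (t - (2 / 3 - ε))) t :=
    (hasDerivAt_rampE ε (t - (2 / 3 - ε))).comp_sub_const t (2 / 3 - ε)
  exact (((h1.sub h2).add h3).const_mul (4 / (1 / 3 - 2 * ε) ^ 2)).neg

/-- `G_ε″` in closed form. (ours) [cite: Balaban1987RG1, §3 p.270] -/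
theorem deriv2_halfB (ε t : ℝ) :
    deriv (deriv (halfB ε)) t = -(4 / (1 / 3 - 2 * ε) ^ 2 *
      (stepE ε (t - (1 / 3 + ε)) - 2 * stepE ε (t - 1 / 2) + stepE ε (t - (2 / 3 - ε)))) :=
  (hasDerivAt_deriv_halfB ε t).deriv

/-- The second-difference bracket of the smooth step lies in `[−1, 1]`. (ours) [cite: Balaban1987RG1, §3 p.270] -/
theorem abs_stepE_bracket_le (hε : 0 < ε) (hε' : ε < 1 / 6) (t : ℝ) :
    |stepE ε (t - (1 / 3 + ε)) - 2 * stepE ε (t - 1 / 2) + stepE ε (t - (2 / 3 - ε))| ≤ 1 := by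
  have m1 := stepE_monotone hε (show t - 1 / 2 ≤ t - (1 / 3 + ε) by linarith)
  have m2 := stepE_monotone hε (show t - (2 / 3 - ε) ≤ t - 1 / 2 by linarith)
  have u1 := stepE_le_one ε (t - (1 / 3 + ε))
  have l3 := stepE_nonneg ε (t - (2 / 3 - ε))
  rw [abs_le]
  constructor <;> linarith

/-- `4/(1/3 − 2ε)² = 36/(1 − 6ε)²`. (ours) [cite: Balaban1987RG1, §3 p.270] -/
theorem four_div_sq_eq (ε : ℝ) : 4 / (1 / 3 - 2 * ε) ^ 2 = 36 / (1 - 6 * ε) ^ 2 := by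
  rw [show (1 / 3 - 2 * ε) = (1 - 6 * ε) / 3 by ring, div_pow]
  rcases eq_or_ne (1 - 6 * ε) 0 with h | h
  · simp [h]
  · field_simp
    ring

/-- **`|G_ε″| ≤ 36/(1 − 6ε)²`**. (ours) [cite: Balaban1987RG1, §3 p.270] -/
theorem abs_deriv2_halfB_le (hε : 0 < ε) (hε' : ε < 1 / 6) (t : ℝ) :
    |deriv (deriv (halfB ε)) t| ≤ 36 / (1 - 6 * ε) ^ 2 := by
  have hw : (0 : ℝ) < 1 / 3 - 2 * ε := by linarith
  have hpos : (0 : ℝ) < 4 / (1 / 3 - 2 * ε) ^ 2 := by positivity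
  rw [deriv2_halfB, abs_neg, abs_mul, ← four_div_sq_eq, abs_of_pos hpos]
  have := abs_stepE_bracket_le hε hε' t
  nlinarith

/-- `G_ε″ = 0` on `(−∞, 1/3]`. (ours) [cite: Balaban1987RG1, §3 p.270] -/
theorem deriv2_halfB_eq_zero_of_le (hε : 0 < ε) (hε' : ε < 1 / 6) {t : ℝ} (ht : t ≤ 1 / 3) :
    deriv (deriv (halfB ε)) t = 0 := by
  rw [deriv2_halfB, stepE_eq_zero hε (show t - (1 / 3 + ε) ≤ -ε by linarith),
    stepE_eq_zero hε (show t - 1 / 2 ≤ -ε by linarith), stepE_eq_zero hε (show t - (2 / 3 - ε) ≤ -ε by linarith)]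
  simp

/-- `G_ε″ = 0` on `[2/3, ∞)`. (ours) [cite: Balaban1987RG1, §3 p.270] -/
theorem deriv2_halfB_eq_zero_of_ge (hε : 0 < ε) (hε' : ε < 1 / 6) {t : ℝ} (ht : 2 / 3 ≤ t) :
    deriv (deriv (halfB ε)) t = 0 := by
  rw [deriv2_halfB, stepE_eq_one hε (show ε ≤ t - (1 / 3 + ε) by linarith),
    stepE_eq_one hε (show ε ≤ t - 1 / 2 by linarith), stepE_eq_one hε (show ε ≤ t - (2 / 3 - ε) by linarith)]
  norm_num

/-- The smoothed tent `Ψ_ε(t − 1/3 − ε) − 2Ψ_ε(t − 1/2) + Ψ_ε(t − 2/3 + ε)` is nonnegative (the step is monotone and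
the two windows have the same length `1/6 − ε`). (ours) [cite: Balaban1987RG1, §3 p.270] -/
theorem rampE_bracket_nonneg (hε : 0 < ε) (hε' : ε < 1 / 6) (t : ℝ) :
    0 ≤ rampE ε (t - (1 / 3 + ε)) - 2 * rampE ε (t - 1 / 2) + rampE ε (t - (2 / 3 - ε)) := by
  have hl : 0 ≤ 1 / 6 - ε := by linarith
  have h1 : rampE ε (t - (1 / 3 + ε)) - rampE ε (t - 1 / 2)
      = ∫ u in (t - (2 / 3 - ε))..(t - 1 / 2), stepE ε (u + (1 / 6 - ε)) := by
    rw [rampE_sub_rampE, intervalIntegral.integral_comp_add_right]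
    congr 1 <;> ring
  have h2 : rampE ε (t - 1 / 2) - rampE ε (t - (2 / 3 - ε))
      = ∫ u in (t - (2 / 3 - ε))..(t - 1 / 2), stepE ε u := rampE_sub_rampE ε _ _
  have hmono : ∫ u in (t - (2 / 3 - ε))..(t - 1 / 2), stepE ε u
      ≤ ∫ u in (t - (2 / 3 - ε))..(t - 1 / 2), stepE ε (u + (1 / 6 - ε)) :=
    intervalIntegral.integral_mono_on (by linarith) ((continuous_stepE ε).intervalIntegrable _ _)
      (((continuous_stepE ε).comp (continuous_id.add continuous_const)).intervalIntegrable _ _)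
      fun u _ => stepE_monotone hε (by linarith)
  linarith

/-- `G_ε` is antitone. (ours) [cite: Balaban1987RG1, §3 p.270] -/
theorem halfB_antitone (hε : 0 < ε) (hε' : ε < 1 / 6) : Antitone (halfB ε) :=
  antitone_of_deriv_nonpos (differentiable_halfB ε) fun t => by
    rw [deriv_halfB]
    simp only [neg_nonpos]
    exact mul_nonneg (by positivity) (rampE_bracket_nonneg hε hε' t)

/-- `0 ≤ G_ε ≤ 1`. (ours) [cite: Balaban1987RG1, §3 p.270] -/
theorem halfB_mem_Icc (hε : 0 < ε) (hε' : ε < 1 / 6) (t : ℝ) : halfB ε t ∈ Icc (0 : ℝ) 1 := by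
  rcases le_total t (1 / 3) with h | h
  · rw [halfB_eq_one hε hε' h]; exact ⟨zero_le_one, le_rfl⟩
  rcases le_total (2 / 3) t with h' | h'
  · rw [halfB_eq_zero hε hε' h']; exact ⟨le_rfl, zero_le_one⟩
  exact ⟨(halfB_eq_zero hε hε' (le_refl _)).symm.le.trans (halfB_antitone hε hε' h'),
    (halfB_antitone hε hε' h).trans (halfB_eq_one hε hε' (le_refl _)).le⟩

/-- **Point symmetry about `(1/2, 1/2)`**: `G_ε(t) + G_ε(1 − t) = 1`. (ours) [cite: Balaban1987RG1, §3 p.270] -/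
theorem halfB_add_halfB_one_sub (hε : 0 < ε) (hε' : ε < 1 / 6) (t : ℝ) :
    halfB ε t + halfB ε (1 - t) = 1 := by
  unfold halfB
  have h1 := ramp2E_add_ramp2E_neg hε (t - (1 / 3 + ε))
  have h2 := ramp2E_add_ramp2E_neg hε (t - 1 / 2)
  have h3 := ramp2E_add_ramp2E_neg hε (t - (2 / 3 - ε))
  rw [show 1 - t - (1 / 3 + ε) = -(t - (2 / 3 - ε)) by ring, show 1 - t - 1 / 2 = -(t - 1 / 2) by ring,
    show 1 - t - (2 / 3 - ε) = -(t - (1 / 3 + ε)) by ring]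
  have hw : (1 / 3 - 2 * ε) ≠ 0 := by linarith
  have key : (ramp2E ε (t - (1 / 3 + ε)) - 2 * ramp2E ε (t - 1 / 2) + ramp2E ε (t - (2 / 3 - ε)))
      + (ramp2E ε (-(t - (2 / 3 - ε))) - 2 * ramp2E ε (-(t - 1 / 2)) + ramp2E ε (-(t - (1 / 3 + ε))))
      = (1 / 3 - 2 * ε) ^ 2 / 4 := by nlinarith
  calc 1 - 4 / (1 / 3 - 2 * ε) ^ 2 * (ramp2E ε (t - (1 / 3 + ε)) - 2 * ramp2E ε (t - 1 / 2)
          + ramp2E ε (t - (2 / 3 - ε)))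
        + (1 - 4 / (1 / 3 - 2 * ε) ^ 2 * (ramp2E ε (-(t - (2 / 3 - ε))) - 2 * ramp2E ε (-(t - 1 / 2))
          + ramp2E ε (-(t - (1 / 3 + ε)))))
      = 2 - 4 / (1 / 3 - 2 * ε) ^ 2 * ((ramp2E ε (t - (1 / 3 + ε)) - 2 * ramp2E ε (t - 1 / 2)
          + ramp2E ε (t - (2 / 3 - ε)))
        + (ramp2E ε (-(t - (2 / 3 - ε))) - 2 * ramp2E ε (-(t - 1 / 2)) + ramp2E ε (-(t - (1 / 3 + ε))))) := by
        ring
    _ = 1 := by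
        have h4 : 4 / (1 / 3 - 2 * ε) ^ 2 * ((1 / 3 - 2 * ε) ^ 2 / 4) = 1 := by
          rw [div_mul_div_comm, mul_comm (4 : ℝ) ((1 / 3 - 2 * ε) ^ 2)]
          exact div_self (mul_ne_zero (pow_ne_zero 2 hw) four_ne_zero)
        rw [key, h4]; norm_num


/-! ### The profile `ζ_{B,ε} = G_ε − G_ε(· + 1)` -/

/-- **«ζ(t) = 1 for |t| ≦ 1/3»** for `ζ_{B,ε}`. (ours) [cite: Balaban1987RG1, §3 p.270] -/
theorem zetaB_eq_one (hε : 0 < ε) (hε' : ε < 1 / 6) {t : ℝ} (ht : |t| ≤ 1 / 3) : zetaB ε t = 1 := by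
  obtain ⟨h1, h2⟩ := abs_le.mp ht
  unfold zetaB
  rw [halfB_eq_one hε hε' h2, halfB_eq_zero hε hε' (by linarith)]
  norm_num

/-- **«ζ(t) = 0 for |t| ≧ 2/3»** for `ζ_{B,ε}`. (ours) [cite: Balaban1987RG1, §3 p.270] -/
theorem zetaB_eq_zero (hε : 0 < ε) (hε' : ε < 1 / 6) {t : ℝ} (ht : 2 / 3 ≤ |t|) : zetaB ε t = 0 := by
  unfold zetaB
  rcases le_abs'.mp ht with h | h
  · rw [halfB_eq_one hε hε' (by linarith), halfB_eq_one hε hε' (by linarith)]; norm_num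
  · rw [halfB_eq_zero hε hε' h, halfB_eq_zero hε hε' (by linarith)]; norm_num

/-- `0 ≤ ζ_{B,ε}`. (ours) [cite: Balaban1987RG1, §3 p.270] -/
theorem zetaB_nonneg (hε : 0 < ε) (hε' : ε < 1 / 6) (t : ℝ) : 0 ≤ zetaB ε t := by
  unfold zetaB
  have := halfB_antitone hε hε' (show t ≤ t + 1 by linarith)
  linarith

/-- `ζ_{B,ε} ≤ 1`. (ours) [cite: Balaban1987RG1, §3 p.270] -/
theorem zetaB_le_one (hε : 0 < ε) (hε' : ε < 1 / 6) (t : ℝ) : zetaB ε t ≤ 1 := by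
  unfold zetaB
  linarith [(halfB_mem_Icc hε hε' t).2, (halfB_mem_Icc hε hε' (t + 1)).1]

/-- `ζ_{B,ε}` is even. (ours) [cite: Balaban1987RG1, §3 p.270] -/
theorem zetaB_neg (hε : 0 < ε) (hε' : ε < 1 / 6) (t : ℝ) : zetaB ε (-t) = zetaB ε t := by
  unfold zetaB
  have h1 := halfB_add_halfB_one_sub hε hε' (-t)
  have h2 := halfB_add_halfB_one_sub hε hε' (t + 1)
  rw [show 1 - -t = t + 1 by ring] at h1
  rw [show 1 - (t + 1) = -t by ring] at h2
  have h3 := halfB_add_halfB_one_sub hε hε' t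
  rw [show (1 : ℝ) - t = -t + 1 by ring] at h3
  linarith

/-- **«ζ ∈ C₀^∞(R¹)»**, smoothness of `ζ_{B,ε}`. (ours) [cite: Balaban1987RG1, §3 p.270] -/
theorem contDiff_zetaB (ε : ℝ) : ContDiff ℝ ∞ (zetaB ε) :=
  (contDiff_halfB ε).sub ((contDiff_halfB ε).comp (contDiff_id.add contDiff_const))

/-- `ζ_{B,ε}′(t) = G_ε′(t) − G_ε′(t + 1)`. (ours) [cite: Balaban1987RG1, §3 p.270] -/
theorem hasDerivAt_zetaB (ε t : ℝ) :
    HasDerivAt (zetaB ε) (deriv (halfB ε) t - deriv (halfB ε) (t + 1)) t :=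
  ((differentiable_halfB ε t).hasDerivAt).sub
    (((differentiable_halfB ε (t + 1)).hasDerivAt).comp_add_const t 1)

/-- `ζ_{B,ε}′` in terms of `G_ε′`. (ours) [cite: Balaban1987RG1, §3 p.270] -/
theorem deriv_zetaB (ε : ℝ) : deriv (zetaB ε) = fun t => deriv (halfB ε) t - deriv (halfB ε) (t + 1) :=
  funext fun t => (hasDerivAt_zetaB ε t).deriv

/-- `ζ_{B,ε}″(t) = G_ε″(t) − G_ε″(t + 1)`. (ours) [cite: Balaban1987RG1, §3 p.270] -/
theorem hasDerivAt_deriv_zetaB (ε t : ℝ) :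
    HasDerivAt (deriv (zetaB ε)) (deriv (deriv (halfB ε)) t - deriv (deriv (halfB ε)) (t + 1)) t := by
  rw [deriv_zetaB]
  exact (hasDerivAt_deriv_halfB ε t).deriv ▸ (hasDerivAt_deriv_halfB ε (t + 1)).deriv ▸
    ((hasDerivAt_deriv_halfB ε t).sub ((hasDerivAt_deriv_halfB ε (t + 1)).comp_add_const t 1))

/-- `ζ_{B,ε}″` in terms of `G_ε″`. (ours) [cite: Balaban1987RG1, §3 p.270] -/
theorem deriv2_zetaB (ε t : ℝ) :
    deriv (deriv (zetaB ε)) t = deriv (deriv (halfB ε)) t - deriv (deriv (halfB ε)) (t + 1) :=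
  (hasDerivAt_deriv_zetaB ε t).deriv

/-- **`|ζ_{B,ε}″| ≤ 36/(1 − 6ε)²`** — at most one of the two translates of `G_ε″` is nonzero at any point.
(ours) [cite: Balaban1987RG1, §3 p.270] -/
theorem abs_deriv2_zetaB_le (hε : 0 < ε) (hε' : ε < 1 / 6) (t : ℝ) :
    |deriv (deriv (zetaB ε)) t| ≤ 36 / (1 - 6 * ε) ^ 2 := by
  rw [deriv2_zetaB]
  rcases le_or_gt t (1 / 3) with h | h
  · rw [deriv2_halfB_eq_zero_of_le hε hε' h, zero_sub, abs_neg]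
    exact abs_deriv2_halfB_le hε hε' _
  · rw [deriv2_halfB_eq_zero_of_ge hε hε' (show 2 / 3 ≤ t + 1 by linarith), sub_zero]
    exact abs_deriv2_halfB_le hε hε' _

/-- **«ζ ∈ C₀^∞(R¹)»**, support: `tsupport ζ_{B,ε} ⊆ [−2/3, 2/3] ⊂ ]−1, 1[`. (ours) [cite: Balaban1987RG1, §3 p.270] -/
theorem tsupport_zetaB_subset (hε : 0 < ε) (hε' : ε < 1 / 6) :
    tsupport (zetaB ε) ⊆ Icc (-(2 / 3)) (2 / 3) := by
  apply closure_minimal _ isClosed_Icc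
  intro t ht
  rw [Function.mem_support] at ht
  by_contra h
  apply ht
  apply zetaB_eq_zero hε hε'
  rw [mem_Icc, not_and_or, not_le, not_le] at h
  rcases h with h | h
  · rw [abs_of_neg (by linarith)]; linarith
  · rw [abs_of_pos (by linarith)]; linarith

/-- `ζ_{B,ε}` has compact support. (ours) [cite: Balaban1987RG1, §3 p.270] -/
theorem hasCompactSupport_zetaB (hε : 0 < ε) (hε' : ε < 1 / 6) : HasCompactSupport (zetaB ε) :=
  HasCompactSupport.of_support_subset_isCompact isCompact_Icc
    (subset_tsupport (zetaB ε) |>.trans (tsupport_zetaB_subset hε hε'))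

/-- Telescoping of the integer translates: `Σ_{k<m} ζ_{B,ε}(u − k) = G_ε(u + 1 − m) − G_ε(u + 1)`.
(ours) [cite: Balaban1987RG1, §3 p.270] -/
theorem sum_zetaB_range (ε u : ℝ) (m : ℕ) :
    ∑ k ∈ Finset.range m, zetaB ε (u - k) = halfB ε (u + 1 - m) - halfB ε (u + 1) := by
  induction m with
  | zero => simp
  | succ m ih =>
    rw [Finset.sum_range_succ, ih]
    unfold zetaB
    push_cast
    ring_nf

/-- **The partition of unity** `Σ_{n=−N}^{N} ζ_{B,ε}(t − n) = 1` for `|t| ≤ N`.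
(ours) [cite: Balaban1987RG1, §3 p.270] -/
theorem sum_zetaB_sub_int (hε : 0 < ε) (hε' : ε < 1 / 6) (N : ℕ) {t : ℝ} (ht : |t| ≤ N) :
    ∑ n ∈ Finset.Icc (-(N : ℤ)) N, zetaB ε (t - n) = 1 := by
  obtain ⟨h1, h2⟩ := abs_le.mp ht
  have himg : Finset.Icc (-(N : ℤ)) N = (Finset.range (2 * N + 1)).image (fun k : ℕ => (k : ℤ) - N) := by
    ext n
    simp only [Finset.mem_Icc, Finset.mem_image, Finset.mem_range]
    constructor
    · rintro ⟨hn1, hn2⟩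
      exact ⟨(n + N).toNat, by omega, by omega⟩
    · rintro ⟨k, hk, rfl⟩
      omega
  rw [himg, Finset.sum_image (by intro a _ b _ hab; simpa using hab)]
  have hsum : ∑ k ∈ Finset.range (2 * N + 1), zetaB ε (t - (((k : ℤ) - N : ℤ) : ℝ))
      = ∑ k ∈ Finset.range (2 * N + 1), zetaB ε (t + N - k) := by
    refine Finset.sum_congr rfl fun k _ => ?_
    push_cast
    ring_nf
  rw [hsum, sum_zetaB_range ε (t + N) (2 * N + 1), halfB_eq_one hε hε' (by push_cast; linarith),
    halfB_eq_zero hε hε' (by linarith)]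
  norm_num


/-! ## §5  `36` is not attained: every `C²` profile has `|ζ″| > 36` somewhere -/

/-- **Strictness of the second-order obstruction.** For every `C²` function with `ζ = 1` on `|t| ≤ 1/3` and `ζ = 0`
on `|t| ≥ 2/3` there is a point with `|ζ″| > 36` (so `36 = inf sup|ζ″|` of `thirtySix_le_deriv2` /
`B12ZetaWitness.thirtySix_le` is not a minimum: equality would force `ζ″ = −36` on `(1/3, 1/2)` and `ζ″ = +36` on
`(1/2, 2/3)`). (ours) [cite: Balaban1987RG1, §3 p.270] -/
theorem exists_thirtySix_lt_abs_deriv2 (ζ : ℝ → ℝ) (hζ : ContDiff ℝ 2 ζ) (hone : ∀ t, |t| ≤ 1 / 3 → ζ t = 1)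
    (hzero : ∀ t, 2 / 3 ≤ |t| → ζ t = 0) : ∃ t, 36 < |deriv (deriv ζ) t| := by
  by_contra hcon
  push Not at hcon
  have hd1 : Differentiable ℝ ζ := hζ.differentiable (by norm_num)
  have hd2 : Differentiable ℝ (deriv ζ) := hζ.differentiable_deriv_two
  have hζ1 : ContDiff ℝ 1 (deriv ζ) := by
    rw [show (2 : ℕ∞ω) = 1 + 1 by norm_num] at hζ
    exact hζ.deriv'
  have hc2 : Continuous (deriv (deriv ζ)) := hζ1.continuous_deriv le_rfl
  have h1 : ∀ t, HasDerivAt ζ (deriv ζ t) t := fun t => (hd1 t).hasDerivAt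
  have h2 : ∀ t, HasDerivAt (deriv ζ) (deriv (deriv ζ) t) t := fun t => (hd2 t).hasDerivAt
  have hζ'c : Continuous (deriv ζ) := continuous_iff_continuousAt.2 fun t => (h2 t).continuousAt
  -- `ζ′(1/3) = 0`, `ζ′(2/3) = 0`
  have hA : deriv ζ (1 / 3) = 0 := by
    refine B12ZetaWitness.deriv_eq_zero_on_closure (s := Ioo (-(1 / 3)) (1 / 3)) (c := 1) isOpen_Ioo h1 hζ'c
      (fun t ht => hone t (abs_le.2 ⟨ht.1.le, ht.2.le⟩)) _ ?_
    rw [closure_Ioo (by norm_num)]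
    exact ⟨by norm_num, le_rfl⟩
  have hB : deriv ζ (2 / 3) = 0 := by
    refine B12ZetaWitness.deriv_eq_zero_on_closure (s := Ioi (2 / 3)) (c := 0) isOpen_Ioi h1 hζ'c
      (fun t ht => hzero t ?_) _ ?_
    · have ht' : (2 : ℝ) / 3 < t := ht
      rw [abs_of_pos (by linarith)]
      exact ht'.le
    · rw [closure_Ioi]
      exact self_mem_Ici
  have hL : ∀ t, |deriv ζ t| ≤ 36 * |t - 1 / 3| := B12ZetaWitness.abs_deriv_le_mul_abs_sub h2 hcon hA
  have hR : ∀ t, |deriv ζ t| ≤ 36 * |t - 2 / 3| := B12ZetaWitness.abs_deriv_le_mul_abs_sub h2 hcon hB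
  have hup := B12ZetaWitness.monotoneOn_Ici_add_sq h1 hL
  have hdown := B12ZetaWitness.monotoneOn_Iic_sub_sq h1 hR
  have e13 : ζ (1 / 3) = 1 := hone _ (by rw [abs_of_pos (by norm_num)])
  have e23 : ζ (2 / 3) = 0 := hzero _ (by rw [abs_of_pos (by norm_num)])
  -- the value at `1/2` is pinned: `ζ(1/2) = 1/2`
  have hu12 := hup (self_mem_Ici) (show (1 : ℝ) / 2 ∈ Ici (1 / 3 : ℝ) by norm_num [mem_Ici]) (by norm_num)
  have hd12 := hdown (show (1 : ℝ) / 2 ∈ Iic (2 / 3 : ℝ) by norm_num [mem_Iic]) (self_mem_Iic) (by norm_num)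
  simp only at hu12 hd12
  rw [e13] at hu12
  rw [e23] at hd12
  have hhalf : ζ (1 / 2) = 1 / 2 := by nlinarith
  -- on `[1/3, 1/2]` the profile IS the extremal parabola `1 − 18(t − 1/3)²`
  have hleft : ∀ t ∈ Icc (1 / 3 : ℝ) (1 / 2), ζ t = 1 - 18 * (t - 1 / 3) ^ 2 := by
    intro t ht
    have a1 := hup (self_mem_Ici) (show t ∈ Ici (1 / 3 : ℝ) from ht.1) ht.1
    have a2 := hup (show t ∈ Ici (1 / 3 : ℝ) from ht.1) (show (1 : ℝ) / 2 ∈ Ici (1 / 3 : ℝ) by norm_num [mem_Ici])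
      ht.2
    simp only at a1 a2
    rw [e13] at a1
    rw [hhalf] at a2
    nlinarith
  -- on `[1/2, 2/3]` it IS `18(t − 2/3)²`
  have hright : ∀ t ∈ Icc (1 / 2 : ℝ) (2 / 3), ζ t = 18 * (t - 2 / 3) ^ 2 := by
    intro t ht
    have a1 := hdown (show (1 : ℝ) / 2 ∈ Iic (2 / 3 : ℝ) by norm_num [mem_Iic]) (show t ∈ Iic (2 / 3 : ℝ) from ht.2)
      ht.1
    have a2 := hdown (show t ∈ Iic (2 / 3 : ℝ) from ht.2) (self_mem_Iic) ht.2
    simp only at a1 a2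
    rw [hhalf] at a1
    rw [e23] at a2
    nlinarith
  -- hence `ζ″ = −36` on `(1/3, 1/2)` and `ζ″ = 36` on `(1/2, 2/3)`
  have hDleft : ∀ t ∈ Ioo (1 / 3 : ℝ) (1 / 2), deriv ζ t = -36 * (t - 1 / 3) := by
    intro t ht
    have hev : ζ =ᶠ[𝓝 t] fun s => 1 - 18 * (s - 1 / 3) ^ 2 :=
      Filter.eventuallyEq_of_mem (Ioo_mem_nhds ht.1 ht.2) fun s hs => hleft s (Ioo_subset_Icc_self hs)
    rw [hev.deriv_eq]
    have : HasDerivAt (fun s : ℝ => 1 - 18 * (s - 1 / 3) ^ 2) (-(18 * (((2 : ℕ) : ℝ) * (t - 1 / 3) ^ (2 - 1) * 1))) t :=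
      ((((hasDerivAt_id t).sub_const (1 / 3)).pow 2).const_mul 18).const_sub 1
    rw [this.deriv]
    push_cast
    ring
  have hDright : ∀ t ∈ Ioo (1 / 2 : ℝ) (2 / 3), deriv ζ t = 36 * (t - 2 / 3) := by
    intro t ht
    have hev : ζ =ᶠ[𝓝 t] fun s => 18 * (s - 2 / 3) ^ 2 :=
      Filter.eventuallyEq_of_mem (Ioo_mem_nhds ht.1 ht.2) fun s hs => hright s (Ioo_subset_Icc_self hs)
    rw [hev.deriv_eq]
    have : HasDerivAt (fun s : ℝ => 18 * (s - 2 / 3) ^ 2) (18 * (((2 : ℕ) : ℝ) * (t - 2 / 3) ^ (2 - 1) * 1)) t :=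
      (((hasDerivAt_id t).sub_const (2 / 3)).pow 2).const_mul 18
    rw [this.deriv]
    push_cast
    ring
  have hDDleft : EqOn (deriv (deriv ζ)) (fun _ => (-36 : ℝ)) (Ioo (1 / 3 : ℝ) (1 / 2)) := by
    intro t ht
    have hev : deriv ζ =ᶠ[𝓝 t] fun s => -36 * (s - 1 / 3) :=
      Filter.eventuallyEq_of_mem (Ioo_mem_nhds ht.1 ht.2) fun s hs => hDleft s hs
    simp only
    rw [hev.deriv_eq]
    have : HasDerivAt (fun s : ℝ => -36 * (s - 1 / 3)) (-36 * 1) t := ((hasDerivAt_id t).sub_const (1 / 3)).const_mul _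
    rw [this.deriv]
    norm_num
  have hDDright : EqOn (deriv (deriv ζ)) (fun _ => (36 : ℝ)) (Ioo (1 / 2 : ℝ) (2 / 3)) := by
    intro t ht
    have hev : deriv ζ =ᶠ[𝓝 t] fun s => 36 * (s - 2 / 3) :=
      Filter.eventuallyEq_of_mem (Ioo_mem_nhds ht.1 ht.2) fun s hs => hDright s hs
    simp only
    rw [hev.deriv_eq]
    have : HasDerivAt (fun s : ℝ => 36 * (s - 2 / 3)) (36 * 1) t := ((hasDerivAt_id t).sub_const (2 / 3)).const_mul _
    rw [this.deriv]
    norm_num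
  -- continuity of `ζ″` at `t = 1/2` is violated
  have hl : deriv (deriv ζ) (1 / 2) = -36 := by
    have := hDDleft.closure hc2 continuous_const
    rw [closure_Ioo (by norm_num)] at this
    exact this ⟨by norm_num, le_rfl⟩
  have hr : deriv (deriv ζ) (1 / 2) = 36 := by
    have := hDDright.closure hc2 continuous_const
    rw [closure_Ioo (by norm_num)] at this
    exact this ⟨le_rfl, by norm_num⟩
  linarith

/-- Hence no `C²` profile with the two plateaus has `|ζ″| ≤ 36` everywhere. (ours) [cite: Balaban1987RG1, §3 p.270] -/
theorem not_abs_deriv2_le_thirtySix (ζ : ℝ → ℝ) (hζ : ContDiff ℝ 2 ζ) (hone : ∀ t, |t| ≤ 1 / 3 → ζ t = 1)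
    (hzero : ∀ t, 2 / 3 ≤ |t| → ζ t = 0) : ¬ ∀ t, |deriv (deriv ζ) t| ≤ 36 := by
  intro h
  obtain ⟨t, ht⟩ := exists_thirtySix_lt_abs_deriv2 ζ hζ hone hzero
  exact absurd ht (not_lt.mpr (h t))

/-! ## §6  The existence theorems: the admissible first-order constants are exactly `(3, ∞)`, the second-order ones
exactly `(36, ∞)`; the printed first-order `5` is achieved -/

/-- **Every `D > 3` is achieved as a first-derivative bound** by a `C₀^∞` profile with ALL the other printed
requirements of p. 270 (and `0 ≤ ζ ≤ 1`, evenness, the partition of unity `Σ_n ζ(t − n) = 1`): take `ζ_{A,ε}` with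
`ε = (1 − 3/D)/6`. Together with `B12Profile270Bounds.exists_three_lt_abs_deriv` (every `C¹` profile exceeds `3`
somewhere) the admissible first-order constants are exactly the `D > 3`. (ours) [cite: Balaban1987RG1, §3 p.270] -/
theorem exists_profile_abs_deriv_le {D : ℝ} (hD : 3 < D) :
    ∃ ζ : ℝ → ℝ, ContDiff ℝ ∞ ζ ∧ HasCompactSupport ζ ∧ (∀ t, |t| ≤ 1 / 3 → ζ t = 1) ∧
      (∀ t, 2 / 3 ≤ |t| → ζ t = 0) ∧ (∀ t, 0 ≤ ζ t ∧ ζ t ≤ 1) ∧ (∀ t, ζ (-t) = ζ t) ∧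
      (∀ (N : ℕ) (t : ℝ), |t| ≤ N → ∑ n ∈ Finset.Icc (-(N : ℤ)) N, ζ (t - n) = 1) ∧
      ∀ t, |deriv ζ t| ≤ D := by
  have hD0 : 0 < D := by linarith
  set ε : ℝ := (1 - 3 / D) / 6 with hε_def
  have h3D : 3 / D < 1 := by rw [div_lt_one hD0]; exact hD
  have h3D' : 0 < 3 / D := by positivity
  have hε : 0 < ε := by rw [hε_def]; linarith
  have hε' : ε < 1 / 6 := by rw [hε_def]; linarith
  refine ⟨zetaA ε, contDiff_zetaA ε, hasCompactSupport_zetaA hε hε', fun t => zetaA_eq_one hε hε',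
    fun t => zetaA_eq_zero hε hε', fun t => ⟨zetaA_nonneg hε hε' t, zetaA_le_one hε hε' t⟩,
    zetaA_neg hε hε', fun N t => sum_zetaA_sub_int hε hε' N, fun t => ?_⟩
  have h := abs_deriv_zetaA_le hε hε' t
  have hval : 3 / (1 - 6 * ε) = D := by
    rw [hε_def]
    field_simp
    ring
  rwa [hval] at h

/-- **The printed first-order constant `5` IS achieved** (by `ζ_{A,1/15}`; the profile of record
`B12PartitionUnity270.zeta` has `sup|ζ′| = 6`, `B12Profile270Bounds.deriv_zeta_neg_half`). (ours)
[cite: Balaban1987RG1, §3 p.270] -/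
theorem exists_profile_abs_deriv_le_five :
    ∃ ζ : ℝ → ℝ, ContDiff ℝ ∞ ζ ∧ HasCompactSupport ζ ∧ (∀ t, |t| ≤ 1 / 3 → ζ t = 1) ∧
      (∀ t, 2 / 3 ≤ |t| → ζ t = 0) ∧ (∀ t, 0 ≤ ζ t ∧ ζ t ≤ 1) ∧ (∀ t, ζ (-t) = ζ t) ∧
      (∀ (N : ℕ) (t : ℝ), |t| ≤ N → ∑ n ∈ Finset.Icc (-(N : ℤ)) N, ζ (t - n) = 1) ∧
      ∀ t, |deriv ζ t| ≤ 5 :=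
  exists_profile_abs_deriv_le (by norm_num)

/-- **Every `K > 36` is achieved as a second-derivative bound** by a `C₀^∞` profile with all the other printed
requirements (and `0 ≤ ζ ≤ 1`, evenness, the partition of unity): take `ζ_{B,ε}` with `ε = (1 − 6/√K)/6`. Together
with `B12PartitionUnity270.thirtySix_le_deriv2` / `B12ZetaWitness.thirtySix_le` (`≥ 36` always) and
`exists_thirtySix_lt_abs_deriv2` (`36` itself is not achieved) the admissible second-order constants are exactly the
`K > 36`; the printed `5` is not among them. (ours) [cite: Balaban1987RG1, §3 p.270] -/
theorem exists_profile_abs_deriv2_le {K : ℝ} (hK : 36 < K) :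
    ∃ ζ : ℝ → ℝ, ContDiff ℝ ∞ ζ ∧ HasCompactSupport ζ ∧ (∀ t, |t| ≤ 1 / 3 → ζ t = 1) ∧
      (∀ t, 2 / 3 ≤ |t| → ζ t = 0) ∧ (∀ t, 0 ≤ ζ t ∧ ζ t ≤ 1) ∧ (∀ t, ζ (-t) = ζ t) ∧
      (∀ (N : ℕ) (t : ℝ), |t| ≤ N → ∑ n ∈ Finset.Icc (-(N : ℤ)) N, ζ (t - n) = 1) ∧
      ∀ t, |deriv (deriv ζ) t| ≤ K := by
  have hK0 : 0 < K := by linarith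
  have hsq : 6 < Real.sqrt K := by
    rw [show (6 : ℝ) = Real.sqrt 36 by rw [show (36 : ℝ) = 6 ^ 2 by norm_num, Real.sqrt_sq (by norm_num)]]
    exact Real.sqrt_lt_sqrt (by norm_num) hK
  have hsq0 : 0 < Real.sqrt K := by linarith
  set ε : ℝ := (1 - 6 / Real.sqrt K) / 6 with hε_def
  have h6 : 6 / Real.sqrt K < 1 := by rw [div_lt_one hsq0]; exact hsq
  have h6' : 0 < 6 / Real.sqrt K := by positivity
  have hε : 0 < ε := by rw [hε_def]; linarith
  have hε' : ε < 1 / 6 := by rw [hε_def]; linarith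
  refine ⟨zetaB ε, contDiff_zetaB ε, hasCompactSupport_zetaB hε hε', fun t => zetaB_eq_one hε hε',
    fun t => zetaB_eq_zero hε hε', fun t => ⟨zetaB_nonneg hε hε' t, zetaB_le_one hε hε' t⟩,
    zetaB_neg hε hε', fun N t => sum_zetaB_sub_int hε hε' N, fun t => ?_⟩
  have h := abs_deriv2_zetaB_le hε hε' t
  have hval : 36 / (1 - 6 * ε) ^ 2 = K := by
    have h1 : 1 - 6 * ε = 6 / Real.sqrt K := by rw [hε_def]; ring
    rw [h1, div_pow, Real.sq_sqrt hK0.le]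
    field_simp
    ring
  rwa [hval] at h

/-- **Summary for the printed sentence** «ζ has derivatives up to the second order bounded by 5» (p. 270): the
FIRST-order half is realisable (`exists_profile_abs_deriv_le_five`), the SECOND-order half is not — no `C²` profile
with the two plateaus has `|ζ″| ≤ 36`, let alone `≤ 5` — while every bound `> 36` is realisable. The constant only
enters (3.11)–(3.16), (3.31) as an `O(1)`. (ours) [cite: Balaban1987RG1, §3 p.270] -/
theorem printed_derivative_bounds_p270 :
    (∃ ζ : ℝ → ℝ, ContDiff ℝ ∞ ζ ∧ HasCompactSupport ζ ∧ (∀ t, |t| ≤ 1 / 3 → ζ t = 1) ∧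
      (∀ t, 2 / 3 ≤ |t| → ζ t = 0) ∧ ∀ t, |deriv ζ t| ≤ 5) ∧
    (¬ ∃ ζ : ℝ → ℝ, ContDiff ℝ 2 ζ ∧ (∀ t, |t| ≤ 1 / 3 → ζ t = 1) ∧ (∀ t, 2 / 3 ≤ |t| → ζ t = 0) ∧
      ∀ t, |deriv (deriv ζ) t| ≤ 36) ∧
    (∀ K : ℝ, 36 < K → ∃ ζ : ℝ → ℝ, ContDiff ℝ ∞ ζ ∧ HasCompactSupport ζ ∧ (∀ t, |t| ≤ 1 / 3 → ζ t = 1) ∧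
      (∀ t, 2 / 3 ≤ |t| → ζ t = 0) ∧ ∀ t, |deriv (deriv ζ) t| ≤ K) := by
  refine ⟨?_, ?_, fun K hK => ?_⟩
  · obtain ⟨ζ, h1, h2, h3, h4, -, -, -, h8⟩ := exists_profile_abs_deriv_le_five
    exact ⟨ζ, h1, h2, h3, h4, h8⟩
  · rintro ⟨ζ, hζ, hone, hzero, h36⟩
    exact not_abs_deriv2_le_thirtySix ζ hζ hone hzero h36
  · obtain ⟨ζ, h1, h2, h3, h4, -, -, -, h8⟩ := exists_profile_abs_deriv2_le hK
    exact ⟨ζ, h1, h2, h3, h4, h8⟩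

end Literature.MathematicalPhysics.QuantumFieldTheory.Balaban1983to89.B12Profile270Witness

end
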